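import Summits.CriticalPhenomena.PercolationContinuityZ3.Theorems.Transplant.Slab111HubBuild2
import Summits.CriticalPhenomena.PercolationContinuityZ3.Theorems.Transplant.Slab111HubEntry
import HarnessLib

/-!
# The HUB ROUTING of the `(111)`-films, XV: entries with BOUNDARY-CAPABLE legs and LOCAL separation — `Entry.swap2`

builds on p205010 (kernel theorem, internal audit signed; external expert review pending) — NOT used in this file.  Lane `prim-bschramm`, seat
`prim-bschramm-p2` (gen 36; class C1b; memo `HOME/bschramm/P2-LATTICES.md` §130); helper file (`--supports stmt-CriticalPhenomena-4575 --as helper`).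
The table language v3 of the gen-36 dispatcher: a leg may make ONE OUTWARD level (relative levels `dir·Δℓ ∈ [−1, Λ]` for its non-terminal vertices,
`LegFits2`, §1); the membership of its low vertices (`dir·Δℓ ≤ 0`, possibly on the boundary levels `0 / k`) is supplied by the dispatcher
(`hm1–hm3`); and each separation hypothesis `sIJ` of «Slab111HubEntry».`Entry.swap` gets a FOURTH alternative — the local, level-aware form for a
tight pair (`LocSep`, §1): every non-last vertex of leg `I` over a column of face `J` lies strictly before the start of `J`'s segment.  **`Entry.swap2`**
(§2) assembles a «Slab111HubPlan2».`HubPlan2` and returns the swap pair.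
[cite: DuminilCopinSidoraviciusTassion2016, §2.3 (proof of Fact 2: the three disjoint paths γ_u, γ_v, γ_w in B_R(z))]
-/

noncomputable section

namespace Summit.CriticalPhenomena.PercolationContinuityZ3.Theorems.Transplant

open Literature.Probability.Percolation Literature.Probability.LatticeModels SimpleGraph
open scoped Classical

namespace Slab111

variable {k : ℕ}

/-! ## §1 Legs with one outward level; local separation -/

/-- **Well-formedness of a boundary-capable leg**: as «Slab111HubEntry».`LegFits` but the non-terminal vertices are at relative levels
`dir·Δℓ ∈ [−1, Λ]` (one outward level allowed). [folklore] -/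
def LegFits2 (l : List MV) (q : ℤ × ℤ) (F : FaceD) (C : List (ℤ × ℤ)) (dir Λ : ℤ) : Prop :=
  ∃ h : LegOK l, F.mem (q + (l.getLast h.1).1) ∧ 0 ≤ dir * (l.getLast h.1).2 ∧ dir * (l.getLast h.1).2 ≤ Λ ∧
    (∀ p ∈ l, p ≠ l.getLast h.1 → ¬ F.mem (q + p.1)) ∧
    (∀ p ∈ l, p ≠ ((0, 0), 0) → q + p.1 ∈ C ∧ -1 ≤ dir * p.2 ∧ dir * p.2 ≤ Λ)

/-- **Well-formedness of an entry, table language v3** (legs by `LegFits2`). [folklore] -/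
def Entry.ok2 (e : Entry) (Pc Wc : List (ℤ × ℤ)) (q₁ q₂ q₃ : ℤ × ℤ) (dir₁ dir₂ dir₃ Λ : ℤ) (x21 x31 x12 x32 x13 x23 : Bool) : Prop :=
  e.F1.ok ∧ e.F2.ok ∧ e.F3.ok ∧ e.F1.OffHub ∧ e.F2.OffHub ∧ e.F3.OffHub ∧ e.F1.Disj e.F2 ∧ e.F1.Disj e.F3 ∧ e.F2.Disj e.F3 ∧
  Att e.F1 e.d₁ ∧ Att e.F2 e.d₂ ∧ Att e.F3 e.d₃ ∧
  (e.F1.f0 ∈ Pc ∧ e.F1.f1 ∈ Pc ∧ e.F1.f2 ∈ Pc) ∧ (e.F2.f0 ∈ Pc ∧ e.F2.f1 ∈ Pc ∧ e.F2.f2 ∈ Pc) ∧ (e.F3.f0 ∈ Wc ∧ e.F3.f1 ∈ Wc ∧ e.F3.f2 ∈ Wc) ∧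
  ((0 : ℤ), (0 : ℤ)) ∈ Pc ∧
  LegFits2 e.l₁ q₁ e.F1 Pc dir₁ Λ ∧ LegFits2 e.l₂ q₂ e.F2 Pc dir₂ Λ ∧ LegFits2 e.l₃ q₃ e.F3 Wc dir₃ Λ ∧
  (x21 = true → LegAvoids e.l₁ q₁ e.F2) ∧ (x31 = true → LegAvoids e.l₁ q₁ e.F3) ∧ (x12 = true → LegAvoids e.l₂ q₂ e.F1) ∧
  (x32 = true → LegAvoids e.l₂ q₂ e.F3) ∧ (x13 = true → LegAvoids e.l₃ q₃ e.F1) ∧ (x23 = true → LegAvoids e.l₃ q₃ e.F2)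

/-- The relative level of the last vertex of a leg (`0` for the empty list). [folklore] -/
def lastOff (l : List MV) : ℤ := ((l.getLast?).getD (((0 : ℤ), (0 : ℤ)), (0 : ℤ))).2

/-- **Local separation** of leg `I` (terminal column `qI`, level `nI`, direction `dir`) from the segment of face `FJ` starting at level
`nJ + lastOff lJ`: every non-last vertex of `lI` over a column of `FJ` is strictly before that start, on the `dir` side. [folklore] -/
def LocSep (lI lJ : List MV) (qI : ℤ × ℤ) (FJ : FaceD) (dir nI nJ : ℤ) : Prop :=
  ∀ p ∈ lI, lI.getLast? ≠ some p → ¬ FJ.mem (qI + p.1) ∨ (dir = 1 ∧ nI + p.2 < nJ + lastOff lJ) ∨ (dir = -1 ∧ nJ + lastOff lJ < nI + p.2)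

/-- `lastOff` of a nonempty list is the relative level of `getLast`. [folklore] -/
theorem lastOff_eq {l : List MV} (h : l ≠ []) : lastOff l = (l.getLast h).2 := by
  unfold lastOff; rw [List.getLast?_eq_some_getLast h, Option.getD_some]

/-- Levels of the vertices of a leg fitting by `LegFits2` (`Λ ≥ 1`): within `[n − Λ, n + Λ]`, and `dir·Δℓ ≥ −1`. [folklore] -/
theorem LegFits2.lev_bounds {l : List MV} {q : ℤ × ℤ} {F : FaceD} {C : List (ℤ × ℤ)} {dir Λ : ℤ} (hdir : dir = 1 ∨ dir = -1) (hΛ : 1 ≤ Λ)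
    (h : LegFits2 l q F C dir Λ) {p : MV} (hp : p ∈ l) : -Λ ≤ p.2 ∧ p.2 ≤ Λ ∧ -1 ≤ dir * p.2 := by
  obtain ⟨hl, -, h0, hΛ', -, hrest⟩ := h
  by_cases hp0 : p = ((0, 0), 0)
  · subst hp0; rcases hdir with rfl | rfl <;> simp <;> omega
  · by_cases hpl : p = l.getLast hl.1
    · rw [hpl]; rcases hdir with rfl | rfl <;> refine ⟨?_, ?_, ?_⟩ <;> omega
    · have := (hrest p hp hp0).2; rcases hdir with rfl | rfl <;> refine ⟨?_, ?_, ?_⟩ <;> omega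

/-- A leg vertex is not at a hub level (v3 bounds). [folklore] -/
theorem hub_aux2 {dir LA LD n x Λ : ℤ} (hd : dir = 1 ∨ dir = -1) (hx : -Λ ≤ x ∧ x ≤ Λ ∧ -1 ≤ dir * x)
    (hz : (dir = 1 → n + Λ + 2 ≤ min LA LD) ∧ (dir = -1 → max LA LD + Λ + 2 ≤ n)) : n + x ≠ LA ∧ n + x ≠ LD := by
  rcases hd with e | e
  · have := hz.1 e; subst e
    have h1 := min_le_left LA LD; have h2 := min_le_right LA LD
    constructor <;> omega
  · have := hz.2 e; subst e
    have h1 := le_max_left LA LD; have h2 := le_max_right LA LD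
    constructor <;> omega

/-- The local alternative gives the `HubPlan2` separation. [folklore] -/
theorem loc_aux {dir LA LD nI nJ x eJ Λ : ℤ} (hx : -Λ ≤ x ∧ x ≤ Λ ∧ -1 ≤ dir * x)
    (hz : (dir = 1 → nI + Λ + 2 ≤ min LA LD) ∧ (dir = -1 → max LA LD + Λ + 2 ≤ nI))
    (h : (dir = 1 ∧ nI + x < nJ + eJ) ∨ (dir = -1 ∧ nJ + eJ < nI + x)) :
    nI + x < min (nJ + eJ) (min LA LD - 1) ∨ max (nJ + eJ) (max LA LD + 1) < nI + x := by
  rcases h with ⟨e, hlt⟩ | ⟨e, hlt⟩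
  · left; have := hz.1 e; rw [lt_min_iff]; constructor <;> omega
  · right; have := hz.2 e; rw [max_lt_iff]; constructor <;> omega

/-- The class of a terminal's level from its shadow. [folklore] -/
theorem cls_of_sh_lev {h : Site 2} {c0 : ℤ} (hz : (3 : ℤ) ∣ h 0 + 2 * h 1 - c0) {E : slab111 k} {q : ℤ × ℤ} {n : ℤ}
    (hE : sh E = vcol h q ∧ lev (E : Site 3) = n) : (3 : ℤ) ∣ n - c0 - (q.1 + 2 * q.2) := by
  have ha := (exists_eq_vl E).1
  obtain ⟨hd, -, -⟩ := ha
  rw [hE.1, hE.2] at hd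
  have e : n - c0 - (q.1 + 2 * q.2) = (n - lvl (vcol h q)) + (h 0 + 2 * h 1 - c0) := by
    simp only [lvl, vcol_apply_zero, vcol_apply_one]; ring
  rw [e]; exact dvd_add hd hz

/-- A leg vertex as `vl` over its column at its level. [folklore] -/
theorem absV_eq_vl {h : Site 2} {c0 : ℤ} (hz : (3 : ℤ) ∣ h 0 + 2 * h 1 - c0) {q : ℤ × ℤ} {n : ℤ} (hq : (3 : ℤ) ∣ n - c0 - (q.1 + 2 * q.2))
    {p : MV} (hp : RAdm p) (h0 : 0 ≤ n + p.2) (hk : n + p.2 ≤ k) : absV k (vcol h q) n p = vl k (vcol h (q + p.1)) (n + p.2) := by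
  obtain ⟨hs, hl⟩ := sh_lev_legV (k := k) hz hq hp h0 hk
  rw [(exists_eq_vl (absV k (vcol h q) n p)).2, hs, hl]

/-- Bulk membership of a leg vertex at a level in `[1, k−1]` over a region column. [folklore] -/
theorem absV_mem_bulk {h : Site 2} {c0 : ℤ} (hz : (3 : ℤ) ∣ h 0 + 2 * h 1 - c0) {S : Set (slab111 k)} {C : List (ℤ × ℤ)}
    (hC : ∀ q ∈ C, ∀ L : ℤ, 1 ≤ L → L ≤ (k : ℤ) - 1 → (3 : ℤ) ∣ L - c0 - (q.1 + 2 * q.2) → vl k (vcol h q) L ∈ S)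
    {q : ℤ × ℤ} {n : ℤ} (hq : (3 : ℤ) ∣ n - c0 - (q.1 + 2 * q.2)) {p : MV} (hp : RAdm p) (hcq : q + p.1 ∈ C) (h1 : 1 ≤ n + p.2)
    (hk : n + p.2 ≤ (k : ℤ) - 1) : absV k (vcol h q) n p ∈ S := by
  rw [absV_eq_vl hz hq hp (by omega) (by omega)]
  refine hC _ hcq _ h1 hk ?_
  unfold RAdm at hp
  have e : n + p.2 - c0 - ((q + p.1).1 + 2 * (q + p.1).2) = (n - c0 - (q.1 + 2 * q.2)) + (p.2 - (p.1.1 + 2 * p.1.2)) := by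
    simp only [Prod.fst_add, Prod.snd_add]; ring
  rw [e]; exact dvd_add hq hp

/-! ## §2 The swap pair from a v3 entry -/

set_option maxHeartbeats 1600000 in
/-- **THE SWAP PAIR FROM A v3 ENTRY PLACED IN A GAP.**  As «Slab111HubEntry».`Entry.swap` with: legs by `LegFits2` (`Λ ≥ 1`); the membership
(and existence as film vertices) of the LOW leg vertices (`dir·Δℓ ≤ 0`, non-terminal) supplied directly (`hm1–hm3`); and in every separation
hypothesis `sIJ` a fourth alternative, the local separation `LocSep` for a tight same-side pair. [folklore] -/
theorem Entry.swap2 {h : Site 2} {c0 : ℤ} {W PR : Set (slab111 k)} {E₁ E₂ w' : slab111 k} (e : Entry)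
    (hz : (3 : ℤ) ∣ h 0 + 2 * h 1 - c0) (hPRW : PR ⊆ W) {Pc Wc : List (ℤ × ℤ)}
    (hPc : ∀ q ∈ Pc, ∀ L : ℤ, 1 ≤ L → L ≤ (k : ℤ) - 1 → (3 : ℤ) ∣ L - c0 - (q.1 + 2 * q.2) → vl k (vcol h q) L ∈ PR)
    (hWc : ∀ q ∈ Wc, ∀ L : ℤ, 1 ≤ L → L ≤ (k : ℤ) - 1 → (3 : ℤ) ∣ L - c0 - (q.1 + 2 * q.2) → vl k (vcol h q) L ∈ W)
    {q₁ q₂ q₃ : ℤ × ℤ} {n₁ n₂ n₃ : ℤ}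
    (hE1 : sh E₁ = vcol h q₁ ∧ lev (E₁ : Site 3) = n₁) (hE2 : sh E₂ = vcol h q₂ ∧ lev (E₂ : Site 3) = n₂)
    (hE3 : sh w' = vcol h q₃ ∧ lev (w' : Site 3) = n₃) (hE1P : E₁ ∈ PR) (hE2P : E₂ ∈ PR) (hE3W : w' ∈ W) (hne : E₁ ≠ E₂)
    (hn1 : 0 ≤ n₁ ∧ n₁ ≤ k) (hn2 : 0 ≤ n₂ ∧ n₂ ≤ k) (hn3 : 0 ≤ n₃ ∧ n₃ ≤ k)
    {dir₁ dir₂ dir₃ Λ : ℤ} (hd1 : dir₁ = 1 ∨ dir₁ = -1) (hd2 : dir₂ = 1 ∨ dir₂ = -1) (hd3 : dir₃ = 1 ∨ dir₃ = -1) (hΛ : 1 ≤ Λ)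
    {x21 x31 x12 x32 x13 x23 : Bool} (hok : e.ok2 Pc Wc q₁ q₂ q₃ dir₁ dir₂ dir₃ Λ x21 x31 x12 x32 x13 x23)
    (hm1 : ∀ p ∈ e.l₁, p ≠ ((0, 0), 0) → dir₁ * p.2 ≤ 0 → (0 ≤ n₁ + p.2 ∧ n₁ + p.2 ≤ k) ∧ vl k (vcol h (q₁ + p.1)) (n₁ + p.2) ∈ PR)
    (hm2 : ∀ p ∈ e.l₂, p ≠ ((0, 0), 0) → dir₂ * p.2 ≤ 0 → (0 ≤ n₂ + p.2 ∧ n₂ + p.2 ≤ k) ∧ vl k (vcol h (q₂ + p.1)) (n₂ + p.2) ∈ PR)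
    (hm3 : ∀ p ∈ e.l₃, p ≠ ((0, 0), 0) → dir₃ * p.2 ≤ 0 → (0 ≤ n₃ + p.2 ∧ n₃ + p.2 ≤ k) ∧ vl k (vcol h (q₃ + p.1)) (n₃ + p.2) ∈ W)
    {LA LD : ℤ} (hLA : (3 : ℤ) ∣ LA - c0) (hLD : LD = LA + 3 * dir₁) (hLA2 : 2 ≤ LA) (hLAk : LA ≤ (k : ℤ) - 2) (hLD2 : 2 ≤ LD) (hLDk : LD ≤ (k : ℤ) - 2)
    (hz1 : (dir₁ = 1 → n₁ + Λ + 2 ≤ min LA LD) ∧ (dir₁ = -1 → max LA LD + Λ + 2 ≤ n₁))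
    (hz2 : (dir₂ = 1 → n₂ + Λ + 2 ≤ min LA LD) ∧ (dir₂ = -1 → max LA LD + Λ + 2 ≤ n₂))
    (hz3 : (dir₃ = 1 → n₃ + Λ + 2 ≤ min LA LD) ∧ (dir₃ = -1 → max LA LD + Λ + 2 ≤ n₃))
    (f12 : (n₁ + 2 * Λ < n₂ ∨ n₂ + 2 * Λ < n₁) ∨
      ∀ p ∈ e.l₁, ∀ p' ∈ e.l₂, -Λ ≤ p.2 → p.2 ≤ Λ → -Λ ≤ p'.2 → p'.2 ≤ Λ → (q₁ + p.1, n₁ + p.2) ≠ (q₂ + p'.1, n₂ + p'.2))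
    (f13 : (n₁ + 2 * Λ < n₃ ∨ n₃ + 2 * Λ < n₁) ∨
      ∀ p ∈ e.l₁, ∀ p' ∈ e.l₃, -Λ ≤ p.2 → p.2 ≤ Λ → -Λ ≤ p'.2 → p'.2 ≤ Λ → (q₁ + p.1, n₁ + p.2) ≠ (q₃ + p'.1, n₃ + p'.2))
    (f23 : (n₂ + 2 * Λ < n₃ ∨ n₃ + 2 * Λ < n₂) ∨
      ∀ p ∈ e.l₂, ∀ p' ∈ e.l₃, -Λ ≤ p.2 → p.2 ≤ Λ → -Λ ≤ p'.2 → p'.2 ≤ Λ → (q₂ + p.1, n₂ + p.2) ≠ (q₃ + p'.1, n₃ + p'.2))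
    (s21 : x21 = true ∨ n₁ + Λ < min (n₂ - Λ) (min LA LD - 1) ∨ max (n₂ + Λ) (max LA LD + 1) < n₁ - Λ ∨ LocSep e.l₁ e.l₂ q₁ e.F2 dir₁ n₁ n₂)
    (s31 : x31 = true ∨ n₁ + Λ < min (n₃ - Λ) (min LA LD - 1) ∨ max (n₃ + Λ) (max LA LD + 1) < n₁ - Λ ∨ LocSep e.l₁ e.l₃ q₁ e.F3 dir₁ n₁ n₃)
    (s12 : x12 = true ∨ n₂ + Λ < min (n₁ - Λ) (min LA LD - 1) ∨ max (n₁ + Λ) (max LA LD + 1) < n₂ - Λ ∨ LocSep e.l₂ e.l₁ q₂ e.F1 dir₂ n₂ n₁)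
    (s32 : x32 = true ∨ n₂ + Λ < min (n₃ - Λ) (min LA LD - 1) ∨ max (n₃ + Λ) (max LA LD + 1) < n₂ - Λ ∨ LocSep e.l₂ e.l₃ q₂ e.F3 dir₂ n₂ n₃)
    (s13 : x13 = true ∨ n₃ + Λ < min (n₁ - Λ) (min LA LD - 1) ∨ max (n₁ + Λ) (max LA LD + 1) < n₃ - Λ ∨ LocSep e.l₃ e.l₁ q₃ e.F1 dir₃ n₃ n₁)
    (s23 : x23 = true ∨ n₃ + Λ < min (n₂ - Λ) (min LA LD - 1) ∨ max (n₂ + Λ) (max LA LD + 1) < n₃ - Λ ∨ LocSep e.l₃ e.l₂ q₃ e.F2 dir₃ n₃ n₂) :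
    ∃ r₁ r₂ : VRouteData (film k) PR W E₁ E₂ w', r₁.y = r₂.b ∧ r₁.b = r₂.y := by
  obtain ⟨hF1, hF2, hF3, ho1, ho2, ho3, h12, h13, h23, hA1, hA2, hA3, hF1P, hF2P, hF3W, hhub, hL1, hL2, hL3,
    hx21, hx31, hx12, hx32, hx13, hx23⟩ := hok
  obtain ⟨hl1, he1, he1a, he1b, ho1', hc1⟩ := hL1
  obtain ⟨hl2, he2, he2a, he2b, ho2', hc2⟩ := hL2
  obtain ⟨hl3, he3, he3a, he3b, ho3', hc3⟩ := hL3
  have lb1 := fun p hp => LegFits2.lev_bounds hd1 hΛ ⟨hl1, he1, he1a, he1b, ho1', hc1⟩ (p := p) hp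
  have lb2 := fun p hp => LegFits2.lev_bounds hd2 hΛ ⟨hl2, he2, he2a, he2b, ho2', hc2⟩ (p := p) hp
  have lb3 := fun p hp => LegFits2.lev_bounds hd3 hΛ ⟨hl3, he3, he3a, he3b, ho3', hc3⟩ (p := p) hp
  have hq1 := cls_of_sh_lev hz hE1
  have hq2 := cls_of_sh_lev hz hE2
  have hq3 := cls_of_sh_lev hz hE3
  have ne1 : e.l₁ ≠ [] := hl1.1
  have ne2 : e.l₂ ≠ [] := hl2.1
  have ne3 : e.l₃ ≠ [] := hl3.1
  -- membership + level range of a non-terminal leg vertex: low ones by `hm`, the others in the bulk by the region columns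
  have mem1 : ∀ p ∈ e.l₁, p ≠ ((0, 0), 0) → (0 ≤ n₁ + p.2 ∧ n₁ + p.2 ≤ k) ∧ absV k (vcol h q₁) n₁ p ∈ PR := by
    intro p hp hp0
    by_cases hlow : dir₁ * p.2 ≤ 0
    · obtain ⟨hr, hm⟩ := hm1 p hp hp0 hlow
      exact ⟨hr, by rw [absV_eq_vl hz hq1 (hl1.2.2.2.2 p hp) hr.1 hr.2]; exact hm⟩
    · have hb := lev_aux (dir_cases hd1 (by omega) (hc1 p hp hp0).2.2) hn1 hz1 ⟨hLA2, hLAk⟩ ⟨hLD2, hLDk⟩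
      exact ⟨⟨by omega, by omega⟩, absV_mem_bulk hz hPc hq1 (hl1.2.2.2.2 p hp) (hc1 p hp hp0).1 hb.1 hb.2⟩
  have mem2 : ∀ p ∈ e.l₂, p ≠ ((0, 0), 0) → (0 ≤ n₂ + p.2 ∧ n₂ + p.2 ≤ k) ∧ absV k (vcol h q₂) n₂ p ∈ PR := by
    intro p hp hp0
    by_cases hlow : dir₂ * p.2 ≤ 0
    · obtain ⟨hr, hm⟩ := hm2 p hp hp0 hlow
      exact ⟨hr, by rw [absV_eq_vl hz hq2 (hl2.2.2.2.2 p hp) hr.1 hr.2]; exact hm⟩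
    · have hb := lev_aux (dir_cases hd2 (by omega) (hc2 p hp hp0).2.2) hn2 hz2 ⟨hLA2, hLAk⟩ ⟨hLD2, hLDk⟩
      exact ⟨⟨by omega, by omega⟩, absV_mem_bulk hz hPc hq2 (hl2.2.2.2.2 p hp) (hc2 p hp hp0).1 hb.1 hb.2⟩
  have mem3 : ∀ p ∈ e.l₃, p ≠ ((0, 0), 0) → (0 ≤ n₃ + p.2 ∧ n₃ + p.2 ≤ k) ∧ absV k (vcol h q₃) n₃ p ∈ W := by
    intro p hp hp0
    by_cases hlow : dir₃ * p.2 ≤ 0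
    · obtain ⟨hr, hm⟩ := hm3 p hp hp0 hlow
      exact ⟨hr, by rw [absV_eq_vl hz hq3 (hl3.2.2.2.2 p hp) hr.1 hr.2]; exact hm⟩
    · have hb := lev_aux (dir_cases hd3 (by omega) (hc3 p hp hp0).2.2) hn3 hz3 ⟨hLA2, hLAk⟩ ⟨hLD2, hLDk⟩
      exact ⟨⟨by omega, by omega⟩, absV_mem_bulk hz hWc hq3 (hl3.2.2.2.2 p hp) (hc3 p hp hp0).1 hb.1 hb.2⟩
  -- the local alternative, rewritten with `getLast`
  have loc : ∀ {lI lJ : List MV} {qI : ℤ × ℤ} {FJ : FaceD} {dir nI nJ : ℤ} (hI : lI ≠ []) (hJ : lJ ≠ []),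
      LocSep lI lJ qI FJ dir nI nJ → ∀ p ∈ lI, p ≠ lI.getLast hI →
        ¬ FJ.mem (qI + p.1) ∨ (dir = 1 ∧ nI + p.2 < nJ + (lJ.getLast hJ).2) ∨ (dir = -1 ∧ nJ + (lJ.getLast hJ).2 < nI + p.2) := by
    intro lI lJ qI FJ dir nI nJ hI hJ hloc p hp hpl
    have := hloc p hp (by rw [List.getLast?_eq_some_getLast hI]; exact fun e => hpl (Option.some.inj e).symm)
    rw [lastOff_eq hJ] at this
    exact this
  have P : HubPlan2 k h c0 W PR E₁ E₂ w' :=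
  { Pc := Pc, Wc := Wc, q₁ := q₁, q₂ := q₂, q₃ := q₃, n₁ := n₁, n₂ := n₂, n₃ := n₃,
    F1 := e.F1, F2 := e.F2, F3 := e.F3, d₁ := e.d₁, d₂ := e.d₂, d₃ := e.d₃, l₁ := e.l₁, l₂ := e.l₂, l₃ := e.l₃,
    LA := LA, LD := LD, τ := dir₁,
    hz := hz, hPRW := hPRW, hPc := hPc, hWc := hWc, hE1 := hE1, hE2 := hE2, hE3 := hE3, hE1P := hE1P, hE2P := hE2P, hE3W := hE3W, hne := hne,
    hF1 := hF1, hF2 := hF2, hF3 := hF3, ho1 := ho1, ho2 := ho2, ho3 := ho3, h12 := h12, h13 := h13, h23 := h23, hA1 := hA1, hA2 := hA2, hA3 := hA3,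
    hF1P := hF1P, hF2P := hF2P, hF3W := hF3W, hub_mem := hhub, hl1 := hl1, hl2 := hl2, hl3 := hl3, he1 := he1, he2 := he2, he3 := he3,
    ho1' := ho1', ho2' := ho2', ho3' := ho3',
    hc1 := mem1, hc2 := mem2, hc3 := mem3,
    hn1 := hn1, hn2 := hn2, hn3 := hn3,
    hτ := hd1, hLD := hLD, hLA := hLA, hLA2 := hLA2, hLAk := hLAk, hLD2 := hLD2, hLDk := hLDk,
    hside := side_aux hA1.dir_eq (dir_cases₀ hd1 he1a he1b) hz1,
    s21 := fun p hp hpl => by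
      rcases s21 with hx | hlt | hgt | hloc
      · exact Or.inl (hx21 hx p hp ⟨hl1.1, hpl⟩)
      · exact Or.inr (Or.inl (sep_lo hlt (lb1 p hp).2.1 (lb2 _ (List.getLast_mem hl2.1)).1))
      · exact Or.inr (Or.inr (sep_hi hgt (lb1 p hp).1 (lb2 _ (List.getLast_mem hl2.1)).2.1))
      · rcases loc ne1 ne2 hloc p hp hpl with hc | hl
        · exact Or.inl hc
        · exact Or.inr (loc_aux (lb1 p hp) hz1 hl),
    s31 := fun p hp hpl => by
      rcases s31 with hx | hlt | hgt | hloc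
      · exact Or.inl (hx31 hx p hp ⟨hl1.1, hpl⟩)
      · exact Or.inr (Or.inl (sep_lo hlt (lb1 p hp).2.1 (lb3 _ (List.getLast_mem hl3.1)).1))
      · exact Or.inr (Or.inr (sep_hi hgt (lb1 p hp).1 (lb3 _ (List.getLast_mem hl3.1)).2.1))
      · rcases loc ne1 ne3 hloc p hp hpl with hc | hl
        · exact Or.inl hc
        · exact Or.inr (loc_aux (lb1 p hp) hz1 hl),
    s12 := fun p hp hpl => by
      rcases s12 with hx | hlt | hgt | hloc
      · exact Or.inl (hx12 hx p hp ⟨hl2.1, hpl⟩)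
      · exact Or.inr (Or.inl (sep_lo hlt (lb2 p hp).2.1 (lb1 _ (List.getLast_mem hl1.1)).1))
      · exact Or.inr (Or.inr (sep_hi hgt (lb2 p hp).1 (lb1 _ (List.getLast_mem hl1.1)).2.1))
      · rcases loc ne2 ne1 hloc p hp hpl with hc | hl
        · exact Or.inl hc
        · exact Or.inr (loc_aux (lb2 p hp) hz2 hl),
    s32 := fun p hp hpl => by
      rcases s32 with hx | hlt | hgt | hloc
      · exact Or.inl (hx32 hx p hp ⟨hl2.1, hpl⟩)
      · exact Or.inr (Or.inl (sep_lo hlt (lb2 p hp).2.1 (lb3 _ (List.getLast_mem hl3.1)).1))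
      · exact Or.inr (Or.inr (sep_hi hgt (lb2 p hp).1 (lb3 _ (List.getLast_mem hl3.1)).2.1))
      · rcases loc ne2 ne3 hloc p hp hpl with hc | hl
        · exact Or.inl hc
        · exact Or.inr (loc_aux (lb2 p hp) hz2 hl),
    s13 := fun p hp hpl => by
      rcases s13 with hx | hlt | hgt | hloc
      · exact Or.inl (hx13 hx p hp ⟨hl3.1, hpl⟩)
      · exact Or.inr (Or.inl (sep_lo hlt (lb3 p hp).2.1 (lb1 _ (List.getLast_mem hl1.1)).1))
      · exact Or.inr (Or.inr (sep_hi hgt (lb3 p hp).1 (lb1 _ (List.getLast_mem hl1.1)).2.1))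
      · rcases loc ne3 ne1 hloc p hp hpl with hc | hl
        · exact Or.inl hc
        · exact Or.inr (loc_aux (lb3 p hp) hz3 hl),
    s23 := fun p hp hpl => by
      rcases s23 with hx | hlt | hgt | hloc
      · exact Or.inl (hx23 hx p hp ⟨hl3.1, hpl⟩)
      · exact Or.inr (Or.inl (sep_lo hlt (lb3 p hp).2.1 (lb2 _ (List.getLast_mem hl2.1)).1))
      · exact Or.inr (Or.inr (sep_hi hgt (lb3 p hp).1 (lb2 _ (List.getLast_mem hl2.1)).2.1))
      · rcases loc ne3 ne2 hloc p hp hpl with hc | hl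
        · exact Or.inl hc
        · exact Or.inr (loc_aux (lb3 p hp) hz3 hl),
    hh1 := fun p hp _ => Or.inr (hub_aux2 hd1 (lb1 p hp) hz1),
    hh2 := fun p hp _ => Or.inr (hub_aux2 hd2 (lb2 p hp) hz2),
    hh3 := fun p hp _ => Or.inr (hub_aux2 hd3 (lb3 p hp) hz3),
    d12 := fun p hp hpl p' hp' hpl' heq => by
      have a := lb1 p hp; have b := lb2 p' hp'
      rcases f12 with hfar | hd
      · exact far_aux hfar ⟨a.1, a.2.1⟩ ⟨b.1, b.2.1⟩ (congrArg Prod.snd heq)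
      · exact hd p hp p' hp' a.1 a.2.1 b.1 b.2.1 heq,
    d13 := fun p hp hpl p' hp' hpl' heq => by
      have a := lb1 p hp; have b := lb3 p' hp'
      rcases f13 with hfar | hd
      · exact far_aux hfar ⟨a.1, a.2.1⟩ ⟨b.1, b.2.1⟩ (congrArg Prod.snd heq)
      · exact hd p hp p' hp' a.1 a.2.1 b.1 b.2.1 heq,
    d23 := fun p hp hpl p' hp' hpl' heq => by
      have a := lb2 p hp; have b := lb3 p' hp'
      rcases f23 with hfar | hd
      · exact far_aux hfar ⟨a.1, a.2.1⟩ ⟨b.1, b.2.1⟩ (congrArg Prod.snd heq)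
      · exact hd p hp p' hp' a.1 a.2.1 b.1 b.2.1 heq }
  exact P.swap

end Slab111

end Summit.CriticalPhenomena.PercolationContinuityZ3.Theorems.Transplant

end
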